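import Literature.MathematicalPhysics.QuantumFieldTheory.Balaban1983to89.B9Thm311PosDefViaSpectralGap
import Literature.MathematicalPhysics.QuantumFieldTheory.Balaban1983to89.B9Thm311HessianWeightedLowerBoundY
import Literature.MathematicalPhysics.QuantumFieldTheory.Balaban1983to89.B9Thm311EigenBoundOfMajorant
import Literature.MathematicalPhysics.QuantumFieldTheory.Balaban1983to89.B9Thm310DeltaAIsUnitOfRegYP335AtLettersY
import Literature.MathematicalPhysics.QuantumFieldTheory.Balaban1983to89.B9CubeLettersInvReadDictBMajorants
import Literature.MathematicalPhysics.QuantumFieldTheory.Balaban1983to89.B9Thm311PosViaLocalInversesY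
import Literature.MathematicalPhysics.QuantumFieldTheory.Balaban1983to89.B9SectionCarryingMembersV1

/-!
# `Balaban1983to89.B9Thm311PosDefOfRegYP335AtLettersY` — T. Bałaban, *Propagators for lattice gauge theories in a background field*, Commun. Math. Phys.
# **99** (1985) 389–434 [Balaban1985BackgroundPropagators], THEOREM 3.11 p. 416: `Δ_a(U)` IS POSITIVE DEFINITE ON PRINT's CLASS (3.35) at def-Y's letters of
# record, for every SECTION-CARRYING member above one threshold — ROW 17's located clause `hΔA = PosDefTr 1 (deltaAY …)` DERIVED, by the road «Theorem 3.3's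
# (3.42) bounds on `G = Δ_a⁻¹` + the scale-weighted (3.69) smallness of the curvature ⇒ spectral gap» (FILE D, the assembly; cell `pub-ymgap`, seat
# `dag-n06-j` gen 31, bundle F5 row 17)

statement-level skeleton of published theorems with citation tags; proofs where landed; nothing here is a claim about the Yang–Mills mass gap

THE PRINT.  Thm 3.11 p. 416: *«the operators Δ′_a, G′, (Q′G′²Q′\*)⁻¹, Δ_a, G are positive definite»*; print's proof goes through (3.105)–(3.106) and the
positivity of the local inverses.  THIS FILE proves the positivity of `Δ_a(U)` by a different assembly of PRINTED ingredients: Thm 3.3 p. 399 ((3.42) for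
`G = Δ_a⁻¹`, cell lit-balaban's ASM2 chain), (3.26) p. 395 (`Δ_a ≥ Δ(U)`), (3.69) p. 404 (the curvature part is small), [4] Lemma 2.1 (2.60)–(2.61) p. 234.

THE ARGUMENT.  Let `ℓ(b) = L^{j(b)}η` and `S := M_ℓ·Δ_a(U)·M_ℓ` (real diagonal congruence, self-adjoint for `⟨·,·⟩₁`).  (i) FORM: by (3.26)+(3.69) in weighted form
(`B9Thm311HessianWeightedLowerBoundY`) `⟨A, Δ_a(U)A⟩₁ ≥ −ε·Σ_b ℓ(b)⁻²‖A(b)‖²`, so `⟨B, SB⟩₁ ≥ −ε⟨B, B⟩₁`, `ε = 12(d+1)L²δ_h`, `δ_h = 40e⁴L³·Mα₀` (the class's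
plaquette window).  (ii) SPECTRUM: `S⁻¹ = M_{ℓ⁻¹}·G·M_{ℓ⁻¹}` has the [4]-(2.51) majorant `C₀·ℓ(a)ℓ(a′)⁻¹e^{−δ_Ad(a,a′)}` (Thm 3.3's block read by p33's
`hasMajorant_conj_G_of_eBlockInvB`, diagonal sandwich), whose row sums are `≤ C₀·L·c` ((2.60)+(2.61)); hence every real eigenvalue `λ` of `S` has `|λ| ≥ (C₀Lc)⁻¹`
(`B9Thm311EigenBoundOfMajorant`).  (iii) GAP: `ε·(C₀Lc) < 1` for `Mα₀` small ⟹ `S > 0` (`B9Thm311PosDefViaSpectralGap`) ⟹ `Δ_a(U) > 0`.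

WHAT IS PROVED (sorry-free; 0 `def`).
* §1 bookkeeping at a member: `hs_cutMulY` (`HS((M_rB)(b)) = r(b)²·HS(B(b))`), `len_sec_blkV1` (`ℓ(ιB(blkV1 b)) = L^{levV1 b.src}∕|c_f|` for a section `ιB`),
  `len_sq_mul_weight` (`ℓ² · c_f²(L^{lev})⁻² = 1`).
* §2 the scale sandwich `S = M_rΔM_r` (generic): `sandwich_leftInv`, `isSymmTr_sandwich`, `form_sandwich_ge`, `conj_sandwich_eq`, `hasMajorant_conj_sandwich`,
  `inv_le_abs_eigen_of_leftInv`; §3 `rowSum_weighted_le` ((2.60)+(2.61) at a member).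
* §4 ★★★ **`posDefTr_deltaAY_of_regYP335_section`** — `∃ M₁ a₁ > 0, ∀ x, Function.Surjective β → M₁ ≤ M → ∀ α₀ > 0, M·α₀ ≤ a₁ →
  ∀ U ∈ (bg9YP 𝕄 SU(N) x).Reg335 c₃₅ α₀, PosDefTr 1 (deltaAY x.toKIdx (parSymY …) (parBY …) (GpY … (parSymY …)) U)` (`N ≥ 1`).
  ★★★ `hDeltaA_of_sections` (the (α3)∕`SCMemberY`-shaped form over `(f, ιB, hι)`), ★★ `posDefTr_deltaAY_of_regYR_section` (the certificate's R-premise via `hRP1`, guard `c·M·α₀ ≤ a₁`).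
* §5 ★★★ `posDefTr_deltaAY_at_scMemberY`, ★★★ `hDeltaA_at_scMemberY` — the same AT n06-c's carrier `B9SectionCarryingMembersV1.SCMemberY` (`val`, `ιBsc`, `hιsc`) BY NAME
  (director-ym №300 «INHABITED BY:»: `SCMemberY.nonempty` ∕ `exists_scMember_ge`).
HONEST SCOPE.  COMPOSITION of landed theorems of this seat (g5∕g7∕g11∕g19∕g24∕g31) and of cell lit-balaban (ASM2, FILE 9, the READ dictionary) with elementary
linear algebra; no estimate of [B9] is newly asserted; the positivity is Thm 3.11's conclusion for `Δ_a` ONLY (not for `G′`, `(Q′G′²Q′\*)⁻¹` — those are g7's),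
at SECTION-CARRYING members (inner-corner members stay displayed; n06-c `SCMemberY` ∕ n06-i `surjective_beta_iff`); NOT a node discharge, NOT summit progress;
count-neutral; finite 𝕋 members; nothing continuum ∕ OS ∕ mass gap ∕ Clay.  Cell `pub-ymgap` (HUMAN RULING D-0062), node N06 [B9], seat
`pub-ymgap-dag-n06-j` (harness re-seat gen 31), 2026-08-29.  No `sorry`, no `axiom`, no `instance`, no `notation`, no `def`.  NEW file.
-/

noncomputable section

namespace Literature.MathematicalPhysics.QuantumFieldTheory.Balaban1983to89.B9Thm311PosDefOfRegYP335AtLettersY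

open Literature.MathematicalPhysics.QuantumFieldTheory.Balaban1983to89
open B6RandomWalk B9Thm311ReadingCoords B9Thm39ReadingCoords B9Thm39ReadingAtLetters Node00
open B6KLevelCensusIndexV1 B6Ineq2142KLevelV1 B6GlobalChartV1 B9PinMembersKLevelV1 B9PinGeometryKLevelV1 B9GeoNormsKLevelV1
  B9BackgroundsKLevelV1 B9BackgroundsKLevelV1P B9Thm34Ext
open B9Thm311PosDefViaSpectralGap B9Thm311HessianWeightedLowerBoundY B9Thm311EigenBoundOfMajorant B9Thm310DeltaAIsUnitOfRegYP335AtLettersY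
open Literature.MathematicalPhysics.QuantumFieldTheory.Balaban1983to89.B9Thm37Sum (mulOp mulOp_apply)
open Literature.MathematicalPhysics.QuantumFieldTheory.Balaban1983to89.B9Thm37CubeCoverCommutators (cutMulY cutMulY_apply)
open Literature.MathematicalPhysics.QuantumFieldTheory.Balaban1983to89.B9Eq352DivFormLetters (conj conj_apply coordEquiv)
open Literature.MathematicalPhysics.QuantumFieldTheory.Balaban1983to89.B9CubeLettersInvReadDictBMajorants (hasMajorant_conj_G_of_eBlockInvB)
open Literature.MathematicalPhysics.QuantumFieldTheory.Balaban1983to89.B9GeoLemma21KLevelV1 (rowSum_geo9K_core transferL_geo9K geo9K_dist_comm geo9K_dist_nonneg' geo9K_len_pos geo9K_one_le_L)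
open Literature.MathematicalPhysics.QuantumFieldTheory.Balaban1983to89.B6Cor28 (TransferL)
open Literature.MathematicalPhysics.QuantumFieldTheory.Balaban1983to89.B6RandomWalk (HasMajorant hasMajorant_mono)
open Literature.MathematicalPhysics.QuantumFieldTheory.Balaban1983to89.B9Thm311PosViaLocalInversesY (deltaAY_parSymY_isSymmTr)
open Literature.MathematicalPhysics.QuantumFieldTheory.Balaban1983to89.B9Ineq369CurvatureSmallAtLettersY (hs_nonneg trIP_one_self_eq)
open Literature.MathematicalPhysics.QuantumFieldTheory.Balaban1983to89.B9Thm39OneCubeReadingAtLettersY (geo9Y_M_nonneg)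
open Literature.MathematicalPhysics.QuantumFieldTheory.Balaban1983to89.B9SectBCodedClassR (bg9YC extraYPb)
open Literature.MathematicalPhysics.QuantumFieldTheory.Balaban1983to89.B9FromB6 (EBlock)
open Literature.MathematicalPhysics.QuantumFieldTheory.Balaban1983to89.B9CubeLettersInvReadings (kernelFamilyBInv)
open Literature.MathematicalPhysics.QuantumFieldTheory.Balaban1983to89.B9SectionCarryingMembersV1 (SCMemberY)

/-! ## §1 Bookkeeping at a member: the weight letter `ℓ(b)` and the Hilbert–Schmidt scaling -/

section Book

open scoped Matrix.Norms.L2Operator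

variable {d ℓ : ℕ} {hd : 1 ≤ d + 1} {hL : Odd (ℓ + 1) ∧ 1 < ℓ + 1} {b₀ b₁ : ℝ} {N : ℕ}

/-- `HS((M_rB)(b)) = r(b)²·HS(B(b))`. [cite: Balaban1985BackgroundPropagators, (3.41) p.397 (weights), bookkeeping] -/
theorem hs_cutMulY {S : Type} (r : S → ℝ) (B : S → Matrix (Fin N) (Fin N) ℂ) (s : S) :
    ∑ a, ∑ c, ‖cutMulY r B s a c‖ ^ 2 = r s ^ 2 * ∑ a, ∑ c, ‖B s a c‖ ^ 2 := by
  rw [Finset.mul_sum]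
  refine Finset.sum_congr rfl fun a _ => ?_
  rw [Finset.mul_sum]
  refine Finset.sum_congr rfl fun c _ => ?_
  rw [cutMulY_apply, Matrix.smul_apply, smul_eq_mul, norm_mul, Complex.norm_real, Real.norm_eq_abs, mul_pow, sq_abs]

variable (i : KIdx d ℓ hd hL b₀ b₁)

/-- the level of the carrier block of a fine bond IS the level of its source. [cite: Balaban1984PropagatorsII, (2.3) p.224 (bookkeeping)] -/
theorem blkV1_fst_eq_levV1 (b : FBondY i) : (blkV1 i.hN i.D b).1.1 = levV1 i b.src :=
  (B6Geom246MultiLevelBox.lev_eq_of_blkOf_eq i.D.toDomains rfl).symm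

/-- **THE WEIGHT LETTER AT A SECTION**: for a section `ιB` of `β`, `ℓ(ιB(blkV1 b)) = L^{levV1 b.src}∕|c_f|`. [cite: Balaban1984PropagatorsII, (2.45) p.231 + (2.1) p.224, dictionary] -/
theorem len_sec_blkV1 (ιB : BlkY i → IBondY i) (hι : ∀ s, β i.hN i.D i.hk (ιB s) = s) (b : FBondY i) :
    (geo9K i).len (ιB (blkV1 i.hN i.D b)) = (((ℓ + 1 : ℕ) : ℝ)) ^ levV1 i b.src / |i.cf| := by
  rw [geo9K_len_kGeo, len_eq]
  have hk1 : 1 ≤ i.k := le_trans (by norm_num) i.hk2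
  have h := beta_level i.hN i.D i.hk hk1 (ιB (blkV1 i.hN i.D b))
  rw [hι] at h
  rw [← h, blkV1_fst_eq_levV1]

/-- `ℓ(b)² · (c_f²·(L^{levV1 b.src})⁻²) = 1`. [cite: Balaban1985BackgroundPropagators, (3.41) p.397, bookkeeping] -/
theorem len_sq_mul_weight (ιB : BlkY i → IBondY i) (hι : ∀ s, β i.hN i.D i.hk (ιB s) = s) (b : FBondY i) :
    (geo9K i).len (ιB (blkV1 i.hN i.D b)) ^ 2 * (i.cf ^ 2 * ((((ℓ : ℝ) + 1) ^ levV1 i b.src)⁻¹) ^ 2) = 1 := by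
  rw [len_sec_blkV1 i ιB hι b]
  have hcf : i.cf ≠ 0 := i.hcf
  have hL : (0 : ℝ) < ((ℓ : ℝ) + 1) ^ levV1 i b.src := pow_pos (by positivity) _
  push_cast
  field_simp
  rw [sq_abs]

end Book

/-! ## §2 The scale sandwich `S = M_r·Δ·M_r`: left inverse, symmetry, form bound, coordinates, majorant, eigenvalue bound -/

section Sandwich

open scoped Matrix.Norms.L2Operator

variable {S : Type} {N : ℕ}

/-- `M_{r⁻¹}(M_r Φ) = Φ` for a nowhere-vanishing weight. [cite: Balaban1985BackgroundPropagators, (3.41) p.397 (weights), bookkeeping] -/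
theorem cutMulY_inv_cutMulY {r : S → ℝ} (hr : ∀ s, r s ≠ 0) (Φ : S → Matrix (Fin N) (Fin N) ℂ) :
    cutMulY (fun s => (r s)⁻¹) (cutMulY r Φ) = Φ := by
  rw [cutMulY_cutMulY_fun]
  have : (fun s => (r s)⁻¹ * r s) = fun _ => (1 : ℝ) := funext fun s => inv_mul_cancel₀ (hr s)
  rw [this, cutMulY_constOne]

/-- **LEFT INVERSE OF THE SANDWICH**: if `G(ΔΦ) = Φ` for all `Φ`, then `(M_{r⁻¹}GM_{r⁻¹})((M_rΔM_r)Φ) = Φ`.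
[cite: Balaban1985BackgroundPropagators, (3.27) p.395 (`G = Δ_a⁻¹`), bookkeeping] -/
theorem sandwich_leftInv {r : S → ℝ} (hr : ∀ s, r s ≠ 0)
    {Δ G : (S → Matrix (Fin N) (Fin N) ℂ) →ₗ[ℂ] (S → Matrix (Fin N) (Fin N) ℂ)} (hGΔ : ∀ Φ, G (Δ Φ) = Φ) (Φ : S → Matrix (Fin N) (Fin N) ℂ) :
    (cutMulY (fun s => (r s)⁻¹) ∘ₗ G ∘ₗ cutMulY (fun s => (r s)⁻¹)) ((cutMulY r ∘ₗ Δ ∘ₗ cutMulY r) Φ) = Φ := by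
  simp only [LinearMap.comp_apply]
  rw [cutMulY_inv_cutMulY hr, hGΔ, cutMulY_inv_cutMulY hr]

variable [Fintype S]

/-- the sandwich of a `⟨·,·⟩₁`-symmetric operator by a real multiplication is `⟨·,·⟩₁`-symmetric. [cite: Balaban1985BackgroundPropagators, Thm 3.11 p.416 («symmetric»), bookkeeping] -/
theorem isSymmTr_sandwich (r : S → ℝ) {Δ : (S → Matrix (Fin N) (Fin N) ℂ) →ₗ[ℂ] (S → Matrix (Fin N) (Fin N) ℂ)}
    (hΔ : IsSymmTr (fun _ => (1 : ℝ)) Δ) : IsSymmTr (fun _ => (1 : ℝ)) (cutMulY r ∘ₗ Δ ∘ₗ cutMulY r) := by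
  intro Φ Ψ
  simp only [LinearMap.comp_apply]
  rw [trIP_cutMulY_left, hΔ, trIP_cutMulY_left]

/-- **THE FORM BOUND TRANSPORTS THROUGH THE SANDWICH**: a weighted lower bound `⟨A, ΔA⟩₁ ≥ −ε·Σ_s wgt(s)·HS(A(s))` with `r(s)²·wgt(s) = 1` gives
`⟨B, (M_rΔM_r)B⟩₁ ≥ −ε⟨B, B⟩₁`. [cite: Balaban1985BackgroundPropagators, (3.69) p.404 with (3.41) p.397 (scale weights), bookkeeping] -/
theorem form_sandwich_ge {ε : ℝ} (r wgt : S → ℝ) (hrw : ∀ s, r s ^ 2 * wgt s = 1)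
    {Δ : (S → Matrix (Fin N) (Fin N) ℂ) →ₗ[ℂ] (S → Matrix (Fin N) (Fin N) ℂ)}
    (hΔ : ∀ A : S → Matrix (Fin N) (Fin N) ℂ, -ε * ∑ s, wgt s * ∑ a, ∑ c, ‖A s a c‖ ^ 2 ≤ trIP (fun _ => (1 : ℝ)) A (Δ A))
    (B : S → Matrix (Fin N) (Fin N) ℂ) :
    -ε * trIP (fun _ => (1 : ℝ)) B B ≤ trIP (fun _ => (1 : ℝ)) B ((cutMulY r ∘ₗ Δ ∘ₗ cutMulY r) B) := by
  have h := hΔ (cutMulY r B)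
  have hsum : ∑ s, wgt s * ∑ a, ∑ c, ‖cutMulY r B s a c‖ ^ 2 = trIP (fun _ => (1 : ℝ)) B B := by
    rw [trIP_one_self_eq]
    refine Finset.sum_congr rfl fun s _ => ?_
    rw [hs_cutMulY, ← mul_assoc, mul_comm (wgt s), hrw s, one_mul]
  rw [hsum] at h
  rw [LinearMap.comp_apply, LinearMap.comp_apply, ← trIP_cutMulY_left]
  exact h

variable {ι : Type} [Fintype ι] (b : Module.Basis ι ℝ (Matrix (Fin N) (Fin N) ℂ))

omit [Fintype S] in
/-- coordinates of a sandwich: `conj b (M_r·O·M_r) = mulOp (r∘fst)·conj b O·mulOp (r∘fst)`. [cite: Balaban1984PropagatorsII, (2.51)–(2.52) p.232, bookkeeping] -/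
theorem conj_sandwich_eq (r : S → ℝ) (O : (S → Matrix (Fin N) (Fin N) ℂ) →ₗ[ℂ] (S → Matrix (Fin N) (Fin N) ℂ)) :
    conj b ((cutMulY r ∘ₗ O ∘ₗ cutMulY r).restrictScalars ℝ) =
      mulOp (fun p : S × ι => r p.1) * conj b (O.restrictScalars ℝ) * mulOp (fun p : S × ι => r p.1) := by
  rw [← conj_cutMulY_restrict_eq_mulOp b r]
  show (coordEquiv b).conj _ = ((coordEquiv b).conj _ ∘ₗ (coordEquiv b).conj _) ∘ₗ (coordEquiv b).conj _
  rw [← LinearEquiv.conj_comp, ← LinearEquiv.conj_comp]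
  rfl

omit [Fintype S] in
/-- **THE [4]-(2.51) MAJORANT OF THE INVERSE SANDWICH**: a majorant `C·ℓ(a)²·E(a,a′)` of `conj b G` and weights `|r(s)| ≦ ℓ(blk s)⁻¹` give the majorant
`C·ℓ(a)·ℓ(a′)⁻¹·E(a,a′)` of `conj b (M_rGM_r)`. [cite: Balaban1984PropagatorsII, (2.51)–(2.52) p.232; Balaban1985BackgroundPropagators, (3.42) p.397 (`G`: profile `ℓ(a)²`)] -/
theorem hasMajorant_conj_sandwich {g : B6.Geometry} (blk' : S → g.Site) (len : g.Site → ℝ) (hlen : ∀ a, 0 < len a)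
    {r : S → ℝ} (hr : ∀ s, |r s| ≤ (len (blk' s))⁻¹)
    {G : (S → Matrix (Fin N) (Fin N) ℂ) →ₗ[ℂ] (S → Matrix (Fin N) (Fin N) ℂ)} {C : ℝ} {E : g.Site → g.Site → ℝ}
    (hG : HasMajorant (fun p : S × ι => blk' p.1) (conj b (G.restrictScalars ℝ)) (fun a a' => C * len a ^ 2 * E a a')) :
    HasMajorant (fun p : S × ι => blk' p.1) (conj b ((cutMulY r ∘ₗ G ∘ₗ cutMulY r).restrictScalars ℝ))
      (fun a a' => C * len a * (len a')⁻¹ * E a a') := by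
  rw [conj_sandwich_eq]
  refine hasMajorant_mono _ (hasMajorant_mulOp_sandwich (fun p : S × ι => blk' p.1) hG (ρ := fun p : S × ι => r p.1)
    (c := fun a => (len a)⁻¹) (fun a => (inv_pos.2 (hlen a)).le) (fun p => hr p.1)) fun a a' => le_of_eq ?_
  have := (hlen a).ne'
  field_simp

/-- **THE SPECTRAL CONSEQUENCE**: if `Tinv(TΦ) = Φ` for all `Φ` and `conj b Tinv` has a majorant with row sums `≦ R` (`R > 0`), then every real eigenvalue `μ` of `T`
has `|μ| ≥ R⁻¹`. [cite: Balaban1984PropagatorsII, (2.51) p.232 + Lemma 2.1 p.234, bookkeeping] -/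
theorem inv_le_abs_eigen_of_leftInv {g : B6.Geometry} (blk : S × ι → g.Site)
    {T Tinv : (S → Matrix (Fin N) (Fin N) ℂ) →ₗ[ℂ] (S → Matrix (Fin N) (Fin N) ℂ)} (hinv : ∀ Φ, Tinv (T Φ) = Φ)
    {K : g.Site → g.Site → ℝ} (hK : HasMajorant blk (conj b (Tinv.restrictScalars ℝ)) K) {R : ℝ} (hR : 0 < R) (hrow : ∀ a, ∑ y', K a y' ≤ R)
    (μ : ℝ) (Φ : S → Matrix (Fin N) (Fin N) ℂ) (hΦ : Φ ≠ 0) (h : T Φ = (μ : ℂ) • Φ) : R⁻¹ ≤ |μ| := by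
  have hΦeq : (μ : ℂ) • Tinv Φ = Φ := by
    have := hinv Φ
    rwa [h, map_smul] at this
  have hμ0 : μ ≠ 0 := by
    rintro rfl
    apply hΦ
    rw [← hΦeq]
    simp
  have hμC : (μ : ℂ) ≠ 0 := by exact_mod_cast hμ0
  have h2 : Tinv Φ = ((μ⁻¹ : ℝ) : ℂ) • Φ := by
    rw [Complex.ofReal_inv, eq_inv_smul_iff₀ hμC, hΦeq]
  have hTinv : (Tinv.restrictScalars ℝ) Φ = μ⁻¹ • Φ := by
    rw [LinearMap.restrictScalars_apply, h2]
    exact Complex.coe_smul _ _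
  have hb := abs_eigen_le_of_conj_hasMajorant b blk (Tinv.restrictScalars ℝ) hK hrow hΦ hTinv
  rw [abs_inv] at hb
  rwa [inv_le_comm₀ hR (abs_pos.2 hμ0)]

end Sandwich

/-! ## §3 The row sum of the weighted profile at a member of the k-level census ((2.60) + (2.61)) -/

section Row

variable {d ℓ : ℕ} {hd : 1 ≤ d + 1} {hL : Odd (ℓ + 1) ∧ 1 < ℓ + 1} {b₀ b₁ : ℝ}

/-- **ROW SUMS OF `C·ℓ(a)ℓ(a′)⁻¹e^{−δ_Ad(a,a′)}` AT A MEMBER**: `≦ C·L^{|1|}·C_row` once `|1|·log L ≦ (δ_A∕2)(2L² − 1)M` ((2.60) at rate `δ_A∕2`, `q = 1`) and the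
rate-`δ_A∕2` row sums are `≦ C_row` ((2.61)). [cite: Balaban1984PropagatorsII, Lemma 2.1 (2.60)–(2.61) p.234] -/
theorem rowSum_weighted_le (i : KIdx d ℓ hd hL b₀ b₁) [Fintype (geo9K i).Site] {δA C Crow : ℝ} (hδA : 0 < δA) (hC : 0 ≤ C)
    (hrow : ∀ y, ∑ y', Real.exp (-(δA / 2 * (geo9K i).dist y y')) ≤ Crow)
    (hM : |(1 : ℝ)| * Real.log (geo9K i).L ≤ δA / 2 * (2 * ((ℓ : ℝ) + 1) ^ 2 - 1) * (geo9K i).M) (a : (geo9K i).Site) :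
    ∑ a', C * (geo9K i).len a * ((geo9K i).len a')⁻¹ * Real.exp (-(δA * (geo9K i).dist a a')) ≤ C * (geo9K i).L ^ |(1 : ℝ)| * Crow :=
  rowSum_lenRatio_le (g := geo9K i) (Real.rpow_nonneg (le_trans zero_le_one (geo9K_one_le_L i)) _) hC (by linarith) (geo9K_len_pos i)
    (geo9K_dist_nonneg' i) (geo9K_dist_comm i) (transferL_geo9K i (half_pos hδA) 1 hM) hrow a

end Row

/-! ## §4 ★★★ Row 17: `Δ_a(U)` is positive definite on print's class at section-carrying members -/

section Record

open scoped Matrix.Norms.L2Operator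
open B7Prop2SpecialUnitary

variable {N : ℕ} (θ : Stage3Params) (Mstar : ℕ)

/-- ★★★ **THEOREM 3.11 FOR `Δ_a` ON PRINT's CLASS (3.35), AT def-Y's LETTERS OF RECORD, FOR EVERY SECTION-CARRYING MEMBER ABOVE ONE THRESHOLD**: there are
`M₁, a₁ > 0` such that for every member `x` whose carrier-block map `β` is onto (no inner corner), `M₁ ≦ M`, every `α₀ > 0` with `M·α₀ ≦ a₁` and every
`SU(N)`-valued `U ∈ (bg9YP … x).Reg335 c₃₅ α₀`: `PosDefTr 1 (deltaAY x.toKIdx parSymY parBY (GpY parSymY) U)` — row 17's located clause `hΔA`.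
ROAD: `S = M_ℓΔ_aM_ℓ` is `⟨·,·⟩₁`-symmetric with `⟨B, SB⟩₁ ≥ −ε⟨B,B⟩₁` (`ε = 12(d+1)L²·40e⁴L³·Mα₀`, (3.26)+(3.69)) and `S⁻¹ = M_{ℓ⁻¹}GM_{ℓ⁻¹}` has a (2.51)
majorant with row sums `≦ R` (Thm 3.3 + (2.60)–(2.61)), so `spec S ⊂ [−ε, ∞) ∩ {|λ| ≥ R⁻¹}` and `εR < 1` forces `S > 0`, hence `Δ_a > 0`.
[cite: Balaban1985BackgroundPropagators, Thm 3.11 p.416; Thm 3.3 p.399; (3.26) p.395; (3.69) p.404; Balaban1984PropagatorsII, Lemma 2.1 (2.60)–(2.61) p.234, (2.51)–(2.52) p.232] -/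
theorem posDefTr_deltaAY_of_regYP335_section (hN : 1 ≤ N) :
    ∃ M₁ a₁ : ℝ, 0 < M₁ ∧ 0 < a₁ ∧
    ∀ (x : MemberY θ.d₆ θ.ℓ₆ θ.hd' θ.hL' θ.b₀ θ.b₁ Mstar), Function.Surjective (β x.hN x.D x.hk) → M₁ ≤ (geo9Y x).M →
      ∀ α₀ : ℝ, 0 < α₀ → (geo9Y x).M * α₀ ≤ a₁ →
      ∀ U : CfgY (Matrix (Fin N) (Fin N) ℂ) x.toKIdx,
        (bg9YP (Matrix (Fin N) (Fin N) ℂ) (specialUnitaryUnits (Fin N)) x).Reg335 c35Y α₀ U →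
        PosDefTr (fun _ => (1 : ℝ)) (deltaAY x.toKIdx (parSymY x.toKIdx) (parBY x.toKIdx) (GpY x.toKIdx (parSymY x.toKIdx)) U) := by
  classical
  haveI : Nonempty (Fin N) := ⟨⟨0, hN⟩⟩
  haveI instK : ∀ i' : KIdx θ.d₆ θ.ℓ₆ θ.hd' θ.hL' θ.b₀ θ.b₁, Fintype (geo9K i').Site := fun i' => (kGeoU i').fin
  -- Theorem 3.3's (3.42) block of `G = Δ_a⁻¹` and `IsUnit Δ_a` on the class (this seat's file over lit-balaban's ASM2 chain)
  obtain ⟨M₂, a₂, δA, KA, hM₂, ha₂, hδA, hKA, H⟩ := isUnit_deltaAY_and_eBlock_of_regYP335_section (N := N) θ Mstar hN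
  -- [4] Lemma 2.1 (2.61): uniform row sums at rate `δ_A∕2`
  obtain ⟨ML, Crow, hrowC⟩ := rowSum_geo9K_core (d := θ.d₆) (ℓ := θ.ℓ₆) (hd := θ.hd') (hL := θ.hL') (b₀ := θ.b₀) (b₁ := θ.b₁)
    (κ := δA / 2) (half_pos hδA)
  -- constants
  set L : ℝ := (θ.ℓ₆ : ℝ) + 1 with hLdef
  have hL1 : 1 ≤ L := by rw [hLdef]; have : (0 : ℝ) ≤ θ.ℓ₆ := Nat.cast_nonneg _; linarith
  have hL0 : 0 < L := lt_of_lt_of_le one_pos hL1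
  have hMb : 0 ≤ coordBound39 (basis39 (Matrix (Fin N) (Fin N) ℂ)) := norm_nonneg _
  set C₀ : ℝ := coordBound39 (basis39 (Matrix (Fin N) (Fin N) ℂ)) * (∑ j, ‖basis39 (Matrix (Fin N) (Fin N) ℂ) j‖) * KA with hC₀
  have hC₀0 : 0 ≤ C₀ := mul_nonneg (mul_nonneg hMb (Finset.sum_nonneg fun _ _ => norm_nonneg _)) hKA
  set R : ℝ := max (C₀ * L ^ |(1 : ℝ)| * Crow) 1 with hRdef
  have hR1 : 1 ≤ R := le_max_right _ _
  have hR0 : 0 < R := lt_of_lt_of_le one_pos hR1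
  have he4 : 0 < Real.exp 4 := Real.exp_pos _
  set εc : ℝ := 12 * ((θ.d₆ : ℝ) + 1) * L ^ 2 * (40 * Real.exp 4 * L ^ 3) with hεc
  have hεc0 : 0 < εc := by positivity
  set Mtr : ℝ := |(1 : ℝ)| * Real.log L / (δA / 2 * (2 * L ^ 2 - 1)) with hMtr
  set abud : ℝ := min a₂ (min (1 / (10 * L)) (min (1 / (40 * Real.exp 4 * L ^ 3)) (1 / (2 * εc * R)))) with habud
  have habud0 : 0 < abud := by positivity
  refine ⟨max M₂ (max ML (max Mtr 1)), abud, lt_of_lt_of_le hM₂ (le_max_left _ _), habud0, ?_⟩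
  intro x hsurj hM α₀ hα ha U hU
  have hG : specialUnitaryUnits (Fin N) ≤ B7Prop2Explicit.unitaryUnits (Matrix (Fin N) (Fin N) ℂ) := specialUnitaryUnits_le_unitaryUnits
  have hUG : ∀ μ z, U μ z ∈ specialUnitaryUnits (Fin N) := hU.1.1
  -- the member's letters
  have hLK : (kGeo x.toKIdx).L = L := by rw [hLdef]; show (((θ.ℓ₆ + 1 : ℕ) : ℝ)) = _; push_cast; ring
  have hLK9 : (geo9K x.toKIdx).L = L := hLK
  have hMK' : (kGeo x.toKIdx).M = (geo9Y x).M := rfl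
  have hMK9 : (geo9K x.toKIdx).M = (geo9Y x).M := rfl
  have hMα : 0 ≤ (geo9Y x).M * α₀ := mul_nonneg (geo9Y_M_nonneg θ Mstar x) hα.le
  have ha2 : (geo9Y x).M * α₀ ≤ a₂ := ha.trans (min_le_left _ _)
  have ha3 : (geo9Y x).M * α₀ ≤ 1 / (10 * L) := ha.trans ((min_le_right _ _).trans (min_le_left _ _))
  have ha4 : (geo9Y x).M * α₀ ≤ 1 / (40 * Real.exp 4 * L ^ 3) :=
    ha.trans ((min_le_right _ _).trans ((min_le_right _ _).trans (min_le_left _ _)))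
  have ha5 : (geo9Y x).M * α₀ ≤ 1 / (2 * εc * R) :=
    ha.trans ((min_le_right _ _).trans ((min_le_right _ _).trans (min_le_right _ _)))
  -- Theorem 3.3 at the member
  obtain ⟨hunit, hE⟩ := H x hsurj ((le_max_left _ _).trans hM) α₀ hα ha2 U hU
  have hEB := hE (B := bg9YP (Matrix (Fin N) (Fin N) ℂ) (specialUnitaryUnits (Fin N)) x) (fun V => V) (parBY x.toKIdx) U rfl
  -- a section of `β` and the weight letter `ℓ(b) = ℓ(ιB(blkV1 b))`
  obtain ⟨ιB, hι⟩ : ∃ ιB : BlkY x.toKIdx → IBondY x.toKIdx, ∀ s, β x.hN x.D x.hk (ιB s) = s :=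
    ⟨fun s => (hsurj s).choose, fun s => (hsurj s).choose_spec⟩
  obtain ⟨wl, hwl⟩ : ∃ wl : FBondY x.toKIdx → ℝ, ∀ b', wl b' = (geo9K x.toKIdx).len (ιB (blkV1 x.hN x.D b')) := ⟨_, fun _ => rfl⟩
  have hwl0 : ∀ b', 0 < wl b' := fun b' => by rw [hwl]; exact geo9K_len_pos x.toKIdx _
  have hwl1 : ∀ b', wl b' ≠ 0 := fun b' => (hwl0 b').ne'
  -- `S⁻¹ := M_{ℓ⁻¹} G M_{ℓ⁻¹}` is a left inverse of `S := M_ℓ Δ_a M_ℓ`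
  have hGΔ : ∀ Φ, GAY x.toKIdx (parSymY x.toKIdx) (parBY x.toKIdx) (GpY x.toKIdx (parSymY x.toKIdx)) U
      (deltaAY x.toKIdx (parSymY x.toKIdx) (parBY x.toKIdx) (GpY x.toKIdx (parSymY x.toKIdx)) U Φ) = Φ := by
    intro Φ
    rw [← Module.End.mul_apply, GAY_mul_deltaAY x.toKIdx hunit, Module.End.one_apply]
  have hinv := sandwich_leftInv (r := wl) hwl1 hGΔ
  -- (ii) the (2.51) majorant of `conj b S⁻¹` (Thm 3.3's block read by lit-balaban's dictionary, diagonal sandwich) and its row sums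
  have hmajG := hasMajorant_conj_G_of_eBlockInvB x.toKIdx (basis39 (Matrix (Fin N) (Fin N) ℂ)) (Rr := 0) (Hp := True)
    (B := bg9YP (Matrix (Fin N) (Fin N) ℂ) (specialUnitaryUnits (Fin N)) x) (U₁ := U) (fun V => V)
    (GAY x.toKIdx (parSymY x.toKIdx) (parBY x.toKIdx) (GpY x.toKIdx (parSymY x.toKIdx))) (parBY x.toKIdx) hEB hKA ιB hι hMb
    (fun v j => abs_repr_le (basis39 (Matrix (Fin N) (Fin N) ℂ)) v j)
    ((GAY x.toKIdx (parSymY x.toKIdx) (parBY x.toKIdx) (GpY x.toKIdx (parSymY x.toKIdx)) U).restrictScalars ℝ)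
    (fun Λ => LinearMap.restrictScalars_apply ℝ _ Λ)
  have hmajS := hasMajorant_conj_sandwich (basis39 (Matrix (Fin N) (Fin N) ℂ)) (g := toB6 (geo9K x.toKIdx) 0 True)
    (fun b' : FBondY x.toKIdx => ιB (blkV1 x.hN x.D b')) (geo9K x.toKIdx).len (geo9K_len_pos x.toKIdx)
    (r := fun b' => (wl b')⁻¹) (fun b' => by rw [hwl, abs_of_pos (inv_pos.2 (geo9K_len_pos x.toKIdx _))]) hmajG
  have hML : ML ≤ (geo9K x.toKIdx).M := by rw [hMK9]; exact ((le_max_left _ _).trans (le_max_right _ _)).trans hM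
  have hMtr' : Mtr ≤ (geo9Y x).M := ((le_max_left _ _).trans ((le_max_right _ _).trans (le_max_right _ _))).trans hM
  have hMlog : |(1 : ℝ)| * Real.log (geo9K x.toKIdx).L ≤ δA / 2 * (2 * ((θ.ℓ₆ : ℝ) + 1) ^ 2 - 1) * (geo9K x.toKIdx).M := by
    have hden : 0 < δA / 2 * (2 * L ^ 2 - 1) := by
      have : 1 ≤ L ^ 2 := one_le_pow₀ hL1
      have : 0 < 2 * L ^ 2 - 1 := by linarith
      positivity
    have h := (div_le_iff₀ hden).1 hMtr'
    rw [hLK9, hMK9, ← hLdef]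
    linarith
  have hrowS : ∀ a, ∑ a', C₀ * (geo9K x.toKIdx).len a * ((geo9K x.toKIdx).len a')⁻¹ * Real.exp (-(δA * (geo9K x.toKIdx).dist a a')) ≤ R := by
    intro a
    refine (rowSum_weighted_le x.toKIdx hδA hC₀0 (hrowC x.toKIdx hML) hMlog a).trans ?_
    rw [hRdef, hLK9]
    exact le_max_left _ _
  -- hence every real eigenvalue `λ` of `S` has `|λ| ≥ R⁻¹`
  have heig := inv_le_abs_eigen_of_leftInv (basis39 (Matrix (Fin N) (Fin N) ℂ)) (g := toB6 (geo9K x.toKIdx) 0 True)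
    (fun p : FBondY x.toKIdx × κ39 (Matrix (Fin N) (Fin N) ℂ) => ιB (blkV1 x.hN x.D p.1)) hinv hmajS hR0 hrowS
  -- (i) the form bound: the class's plaquette window and (3.26) + (3.69) in scale-weighted form
  have hK1 : 10 * (kGeo x.toKIdx).L * ((kGeo x.toKIdx).M * α₀) ≤ 1 := by
    rw [hLK, hMK']
    have := (le_div_iff₀ (by positivity : (0 : ℝ) < 10 * L)).1 ha3
    linarith
  obtain ⟨δh, hδh⟩ : ∃ δh : ℝ, δh = 40 * Real.exp 4 * L ^ 3 * ((geo9Y x).M * α₀) := ⟨_, rfl⟩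
  have hδh0 : 0 ≤ δh := by rw [hδh]; positivity
  have hδh1 : δh ≤ 1 := by
    have := (le_div_iff₀ (by positivity : (0 : ℝ) < 40 * Real.exp 4 * L ^ 3)).1 ha4
    rw [hδh]; linarith
  have hplaq : ∀ p : PlaqY x.toKIdx, ‖((holY x.toKIdx U p : (Matrix (Fin N) (Fin N) ℂ)ˣ) : Matrix (Fin N) (Fin N) ℂ) - 1‖ ≤
      δh * ((((θ.ℓ₆ : ℝ) + 1) ^ levV1 x.toKIdx p.src)⁻¹) ^ 2 := by
    intro p
    have h := norm_holY_sub_one_le_window_of_reg335P x.toKIdx U (by norm_num [c35Y]) (by rw [hMK']; exact hMα) hK1 hU.1 p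
    rw [hLK, hMK'] at h
    rw [hδh]
    exact h
  have hform := form_sandwich_ge (ε := 12 * ((θ.d₆ : ℝ) + 1) * ((θ.ℓ₆ : ℝ) + 1) ^ 2 * δh) wl
    (fun b' : FBondY x.toKIdx => x.toKIdx.cf ^ 2 * ((((θ.ℓ₆ : ℝ) + 1) ^ levV1 x.toKIdx b'.src)⁻¹) ^ 2)
    (fun b' => by rw [hwl]; exact len_sq_mul_weight x.toKIdx ιB hι b') (trIP_deltaAY_ge_neg_weighted x.toKIdx hG hUG hδh0 hδh1 hplaq)
  -- symmetry of `S`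
  have hsymm := isSymmTr_sandwich wl (deltaAY_parSymY_isSymmTr x.toKIdx hG hUG)
  -- (iii) the gap `ε·R < 1`
  have hεK : 12 * ((θ.d₆ : ℝ) + 1) * ((θ.ℓ₆ : ℝ) + 1) ^ 2 * δh * R < 1 := by
    have h0 : 12 * ((θ.d₆ : ℝ) + 1) * ((θ.ℓ₆ : ℝ) + 1) ^ 2 * δh = εc * ((geo9Y x).M * α₀) := by rw [hδh, hεc, hLdef]; ring
    rw [h0]
    have h2 : εc * ((geo9Y x).M * α₀) * R ≤ εc * (1 / (2 * εc * R)) * R :=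
      mul_le_mul_of_nonneg_right (mul_le_mul_of_nonneg_left ha5 hεc0.le) hR0.le
    have h3 : εc * (1 / (2 * εc * R)) * R = 1 / 2 := by field_simp
    linarith
  have hS := posDefTr_of_isSymmTr_of_form_ge_of_eigen_abs_ge (w := fun _ => (1 : ℝ)) (fun _ => one_pos) _ hsymm hR0 hεK hform heig
  exact posDefTr_of_posDefTr_conj_cutMulY wl hwl1 _ hS

/-- ★★★ **THE (α3)∕`SCMemberY`-SHAPED FORM** (row 17's `hΔA` for families of section-carrying members, cf. this seat's `hunitA_of_sections`): above one threshold
`MΔ₀` and below one budget `aΔ`, for every family `f` of members with sections `ιB` of `β`, every `j`, `α₀ > 0` with `M·α₀ ≦ aΔ`, and every `U` in the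
cube class `(bg9YC … extraYPb … (f j)).Reg335 c₃₅ α₀` (⊇ print's (3.35) data): `PosDefTr 1 (deltaAY (f j).toKIdx parSymY parBY (GpY parSymY) U)`.
[cite: Balaban1985BackgroundPropagators, Thm 3.11 p.416; Thm 3.3 p.399; (3.69) p.404] -/
theorem hDeltaA_of_sections (hN : 1 ≤ N) : ∃ MΔ₀ aΔ : ℝ, 0 < MΔ₀ ∧ 0 < aΔ ∧
    ∀ (MΔ : ℝ), MΔ₀ ≤ MΔ →
    ∀ {J : Type} (f : J → MemberY θ.d₆ θ.ℓ₆ θ.hd' θ.hL' θ.b₀ θ.b₁ Mstar) (ιB : ∀ j : J, BlkY (f j).toKIdx → IBondY (f j).toKIdx)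
      (_hι : ∀ (j : J) (s : BlkY (f j).toKIdx), β (f j).toKIdx.hN (f j).toKIdx.D (f j).toKIdx.hk (ιB j s) = s)
      (j : J) (α₀ : ℝ) (U : CfgY (Matrix (Fin N) (Fin N) ℂ) (f j).toKIdx),
      MΔ ≤ (geo9Y (f j)).M → 0 < α₀ → (geo9Y (f j)).M * α₀ ≤ aΔ →
      (bg9YC (Matrix (Fin N) (Fin N) ℂ) (specialUnitaryUnits (Fin N))
          (extraYPb (Matrix (Fin N) (Fin N) ℂ) (specialUnitaryUnits (Fin N))) (f j)).Reg335 c35Y α₀ U →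
      PosDefTr (fun _ => (1 : ℝ))
        (deltaAY (f j).toKIdx (parSymY (f j).toKIdx) (parBY (f j).toKIdx) (GpY (f j).toKIdx (parSymY (f j).toKIdx)) U) := by
  obtain ⟨M₁, a₁, hM₁, ha₁, h⟩ := posDefTr_deltaAY_of_regYP335_section (N := N) θ Mstar hN
  refine ⟨M₁, a₁, hM₁, ha₁, fun MΔ hMΔ J f ιB hι j α₀ U hM hα ha hU => ?_⟩
  have hP : (bg9YP (Matrix (Fin N) (Fin N) ℂ) (specialUnitaryUnits (Fin N)) (f j)).Reg335 c35Y α₀ U := ⟨⟨hU.1.1, hU.1.2.2⟩, hU.2⟩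
  exact h (f j) (fun s => ⟨ιB j s, hι j s⟩) (hMΔ.trans hM) α₀ hα ha U hP

/-- ★★ **ROW 17 ON THE CERTIFICATE's R-CLASS** (premise `hRP1`: the R-class at rate `c` lies in print's class (3.35) at rate `c₃₅`): the same conclusion for
`U ∈ (bg9YR … x).Reg335 c α₀` under the guard `c·M·α₀ ≦ a₁` (`c > 0`; budget `a₁ = a·c`), at section-carrying members above one threshold.
[cite: Balaban1985BackgroundPropagators, Thm 3.11 p.416 with (3.35) p.396] -/
theorem posDefTr_deltaAY_of_regYR_section (hN : 1 ≤ N)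
    {R₁ R₂ : B9BackgroundsKLevelV1R.RegFamY θ.d₆ θ.ℓ₆ θ.hd' θ.hL' θ.b₀ θ.b₁ Mstar (Matrix (Fin N) (Fin N) ℂ)} {c : ℝ} (hc : 0 < c)
    (hRP1 : ∀ (x : MemberY θ.d₆ θ.ℓ₆ θ.hd' θ.hL' θ.b₀ θ.b₁ Mstar) (α₀ : ℝ)
      (U : (B9BackgroundsKLevelV1R.bg9YR (Matrix (Fin N) (Fin N) ℂ) (specialUnitaryUnits (Fin N)) R₁ R₂ x).Cfg),
      (B9BackgroundsKLevelV1R.bg9YR (Matrix (Fin N) (Fin N) ℂ) (specialUnitaryUnits (Fin N)) R₁ R₂ x).Reg335 c α₀ U →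
        0 ≤ α₀ ∧ (bg9YP (Matrix (Fin N) (Fin N) ℂ) (specialUnitaryUnits (Fin N)) x).Reg335 c35Y α₀ U) :
    ∃ M₁ a₁ : ℝ, 0 < M₁ ∧ 0 < a₁ ∧
    ∀ (x : MemberY θ.d₆ θ.ℓ₆ θ.hd' θ.hL' θ.b₀ θ.b₁ Mstar), Function.Surjective (β x.hN x.D x.hk) → M₁ ≤ (geo9Y x).M →
      ∀ α₀ : ℝ, 0 < α₀ → c * (geo9Y x).M * α₀ ≤ a₁ →
      ∀ U : (B9BackgroundsKLevelV1R.bg9YR (Matrix (Fin N) (Fin N) ℂ) (specialUnitaryUnits (Fin N)) R₁ R₂ x).Cfg,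
        (B9BackgroundsKLevelV1R.bg9YR (Matrix (Fin N) (Fin N) ℂ) (specialUnitaryUnits (Fin N)) R₁ R₂ x).Reg335 c α₀ U →
        PosDefTr (fun _ => (1 : ℝ)) (deltaAY x.toKIdx (parSymY x.toKIdx) (parBY x.toKIdx) (GpY x.toKIdx (parSymY x.toKIdx)) U) := by
  obtain ⟨M₁, a₁, hM₁, ha₁, h⟩ := posDefTr_deltaAY_of_regYP335_section (N := N) θ Mstar hN
  refine ⟨M₁, a₁ * c, hM₁, by positivity, fun x hsurj hM α₀ hα ha U hU => ?_⟩
  refine h x hsurj hM α₀ hα ?_ U (hRP1 x α₀ U hU).2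
  have h1 : c * ((geo9Y x).M * α₀) ≤ c * a₁ := by rw [← mul_assoc, mul_comm c a₁]; exact ha
  exact le_of_mul_le_mul_left h1 hc

/-! ## §5 AT THE SECTION-CARRYING SUB-FAMILY BY NAME (director-ym №300 «INHABITED BY:» — n06-c's carrier `B9SectionCarryingMembersV1`) -/

/-- ★★★ **ROW 17 AT `SCMemberY` BY NAME**: for every section-carrying member `j` (n06-c's carrier `SCMemberY`; INHABITED BY `SCMemberY.nonempty` ∕
`exists_scMember_ge` for odd `L ≥ 5`, `0 < b₀ ≤ b₁` — members exist beyond every threshold), `M₁ ≦ M`, `α₀ > 0`, `M·α₀ ≦ a₁`, and `U ∈ (bg9YP … j.val).Reg335 c₃₅ α₀`: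
`PosDefTr 1 (deltaAY j.val.toKIdx parSymY parBY (GpY parSymY) U)`. [cite: Balaban1985BackgroundPropagators, Thm 3.11 p.416; Balaban1984PropagatorsII, (2.45) p.231] -/
theorem posDefTr_deltaAY_at_scMemberY (hN : 1 ≤ N) :
    ∃ M₁ a₁ : ℝ, 0 < M₁ ∧ 0 < a₁ ∧
    ∀ (j : SCMemberY θ.d₆ θ.ℓ₆ θ.hd' θ.hL' θ.b₀ θ.b₁ Mstar), M₁ ≤ (geo9Y j.val).M →
      ∀ α₀ : ℝ, 0 < α₀ → (geo9Y j.val).M * α₀ ≤ a₁ →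
      ∀ U : CfgY (Matrix (Fin N) (Fin N) ℂ) j.val.toKIdx,
        (bg9YP (Matrix (Fin N) (Fin N) ℂ) (specialUnitaryUnits (Fin N)) j.val).Reg335 c35Y α₀ U →
        PosDefTr (fun _ => (1 : ℝ))
          (deltaAY j.val.toKIdx (parSymY j.val.toKIdx) (parBY j.val.toKIdx) (GpY j.val.toKIdx (parSymY j.val.toKIdx)) U) := by
  obtain ⟨M₁, a₁, hM₁, ha₁, h⟩ := posDefTr_deltaAY_of_regYP335_section (N := N) θ Mstar hN
  exact ⟨M₁, a₁, hM₁, ha₁, fun j hM α₀ hα ha U hU => h j.val j.surjective_beta hM α₀ hα ha U hU⟩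

/-- ★★★ **THE (α3)-SHAPED FORM AT `f := SCMemberY.val`, `ιB := SCMemberY.ιBsc`, `hι := SCMemberY.hιsc` BY NAME** (the ∀-section binder of
`hDeltaA_of_sections` INHABITED by n06-c's canonical sections; `J := SCMemberY …` is non-empty by `SCMemberY.nonempty`): on the cube class
`(bg9YC … extraYPb … j.val).Reg335 c₃₅ α₀`, above `MΔ ≥ MΔ₀` and below `aΔ`, `PosDefTr 1 (deltaAY j.val.toKIdx …)`.
[cite: Balaban1985BackgroundPropagators, Thm 3.11 p.416; Balaban1984PropagatorsII, (2.45) p.231] -/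
theorem hDeltaA_at_scMemberY (hN : 1 ≤ N) : ∃ MΔ₀ aΔ : ℝ, 0 < MΔ₀ ∧ 0 < aΔ ∧
    ∀ (MΔ : ℝ), MΔ₀ ≤ MΔ →
    ∀ (j : SCMemberY θ.d₆ θ.ℓ₆ θ.hd' θ.hL' θ.b₀ θ.b₁ Mstar) (α₀ : ℝ) (U : CfgY (Matrix (Fin N) (Fin N) ℂ) j.val.toKIdx),
      MΔ ≤ (geo9Y j.val).M → 0 < α₀ → (geo9Y j.val).M * α₀ ≤ aΔ →
      (bg9YC (Matrix (Fin N) (Fin N) ℂ) (specialUnitaryUnits (Fin N))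
          (extraYPb (Matrix (Fin N) (Fin N) ℂ) (specialUnitaryUnits (Fin N))) j.val).Reg335 c35Y α₀ U →
      PosDefTr (fun _ => (1 : ℝ))
        (deltaAY j.val.toKIdx (parSymY j.val.toKIdx) (parBY j.val.toKIdx) (GpY j.val.toKIdx (parSymY j.val.toKIdx)) U) := by
  obtain ⟨MΔ₀, aΔ, h0, h1, h⟩ := hDeltaA_of_sections (N := N) θ Mstar hN
  exact ⟨MΔ₀, aΔ, h0, h1, fun MΔ hMΔ j α₀ U hM hα ha hU =>
    h MΔ hMΔ SCMemberY.val SCMemberY.ιBsc SCMemberY.hιsc j α₀ U hM hα ha hU⟩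

end Record

end Literature.MathematicalPhysics.QuantumFieldTheory.Balaban1983to89.B9Thm311PosDefOfRegYP335AtLettersY

end
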